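import Summits.BirchSwinnertonDyer.BirchSwinnertonDyer.Theses.TwistFamilyManinDescent

/-!
# Sketch (g13) — `half-twist-raynaud-window` read at the ORDINARY prime only

Typed skeleton of the refined line for
`TwistFamilyManinDescent.EisensteinAdditiveManinResidual` (stmt-BirchSwinnertonDyer-25138) on the
PRINCIPAL-SERIES (potentially ordinary) rows: `p = 13` (all additive potentially-good Eisenstein rows),
`(5; v₅Δ_min ∈ {3,9})`, `(7; v₇Δ_min ∈ {2,4,8,10})`.

* `EtaleExitAt W p D` — every `p`-isogeny OUT of the `X₀`-optimal curve `W` to a globally minimal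
  curve has `p`-adic unit Néron scalar (= its kernel is étale-type at `p` over the tame good-reduction
  field; = `W` is Serre–Tate-deepest; = `p ∤ [Λ_W : Λ_min]`, Stevens).  This is the shape of the
  route's `EisensteinOrdinaryStrongIsTop` (C2, p = 13) and of I9♯ (corner), stated uniformly.
* `HalfTwistOrdinaryTransfer` — the TRANSFER stub of the line (E-free package at the ordinary prime
  𝔭̄ of ℤ[χ]: level drop L0, identity (★), Σ∞-lemma, 𝔭̄-content zero, μ-depth formula, lowest-terms
  lemma, TWIST-OPT): étale exit ⇒ `p ∤ c`.
* `residualPS_of` — kernel-checked composition onto the PS-restricted residual.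
Statements only; the one `theorem` is glue (no `sorry`).
-/

open Literature.NumberTheory.EllipticCurves.ModularForms

namespace Summit.BirchSwinnertonDyer.BirchSwinnertonDyer.Cruxes.EisensteinAdditiveManinResidual.HalfTwistRaynaudWindow

/-- Principal-series (potentially ORDINARY) Eisenstein rows of the residual: `p = 13` (every additive
potentially-good row has `e ∣ 12`), `(5; III, III*)`, `(7; II, IV, IV*, II*)`. -/
def PSRow (W : WeierstrassCurve ℚ) [W.IsElliptic] [W.IsGloballyMinimal] (p : ℕ) : Prop :=
  p = 13 ∨ (p = 5 ∧ padicValInt 5 W.minimalDiscriminantInt ∈ ({3, 9} : Finset ℕ)) ∨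
    (p = 7 ∧ padicValInt 7 W.minimalDiscriminantInt ∈ ({2, 4, 8, 10} : Finset ℕ))

/-- **Étale exit at `p`** for the parametrised curve `W` (lattice `D.L`): for every globally minimal
`W'` with Néron lattice `L'` and every `μ ∈ ℚ` with `p·L' ⊊ μ·Λ_W ⊊ L'` (so `μ = ±n_ψ` is the Néron
scalar of the rational `p`-isogeny `ψ : W → W'`, Stevens 1989 Thm 2.3) one has `v_p(μ) = 0`. -/
def EtaleExitAt (W : WeierstrassCurve ℚ) [W.IsElliptic] (p : ℕ) {N : ℕ} [NeZero N]
    (D : ModularParametrizationData W N) : Prop :=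
  ∀ (W' : WeierstrassCurve ℚ) [W'.IsElliptic] [W'.IsGloballyMinimal] (L' : PeriodPair),
    IsNeronLatticeOf (W'.baseChange ℂ) L' → ∀ μ : ℚ,
      (∀ y ∈ D.L.lattice, (μ : ℂ) * y ∈ L'.lattice) →
      (∃ z ∈ L'.lattice, ∀ y ∈ D.L.lattice, z ≠ (μ : ℂ) * y) →
      (∀ z ∈ L'.lattice, ∃ y ∈ D.L.lattice, (p : ℂ) * z = (μ : ℂ) * y) →
      (∃ y ∈ D.L.lattice, ∀ z ∈ L'.lattice, (μ : ℂ) * y ≠ (p : ℂ) * z) →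
      padicValRat p μ = 0

/-- **E-facing stub (orientation law, uniform form of C2 ∪ I9♯).** On every PS Eisenstein row the
`X₀`-optimal curve has étale exit at `p`.  Census: p = 13 in-scope 22/22 (C2), corner 1064/1064 (I9♯),
and `p ∤ [Λ_opt : Λ_min]` for all `p ≥ 5`, `N < 60000` except `11a` (Cremona, ARS 2006 Rem. 5.3). -/
def EtaleExitPS : Prop :=
  ∀ (W : WeierstrassCurve ℚ) [W.IsElliptic] [W.IsGloballyMinimal] {N : ℕ} [NeZero N]
    (D : ModularParametrizationData W N) (p : ℕ) (hp : p.Prime),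
    PSRow W p → p ^ 2 ∣ N → ¬ W.HasIrreducibleModPGaloisRep p →
    ¬ ((W.quadraticTwist (((-1 : ℤ) ^ (p / 2) * p : ℤ) : ℚ)).HasGoodReductionAt
          ((Rat.HeightOneSpectrum.primesEquiv (R := ℤ)).symm ⟨p, hp⟩) ∨
        (W.quadraticTwist (((-1 : ℤ) ^ (p / 2) * p : ℤ) : ℚ)).HasMultiplicativeReductionAt
          ((Rat.HeightOneSpectrum.primesEquiv (R := ℤ)).symm ⟨p, hp⟩)) →
    (∀ z ∈ D.L.lattice, ∃ w ∈ periodLattice D.f, z = D.c * w) →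
    EtaleExitAt W p D

/-- **Transfer stub (E-free package at the ordinary prime + TWIST-OPT).** On a PS Eisenstein row,
étale exit of the optimal curve forces `p ∤ c`.  Content: `v_p(c) = cont_𝔭̄(β₀) + μdepth_𝔭̄(ker γ)`
(identity (★) at 𝔭̄, Σ∞-lemma, μ-depth formula), `cont_𝔭̄(β₀) ≤ 0` (content zero), and the
lowest-terms lemma: étale exit (⇔ no `G_ℚ`-stable μ-type line in `A_g[𝔭̄]`, via TWIST-OPT) ⇒
`μdepth = 0`. -/
def HalfTwistOrdinaryTransfer : Prop :=
  ∀ (W : WeierstrassCurve ℚ) [W.IsElliptic] [W.IsGloballyMinimal] {N : ℕ} [NeZero N]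
    (D : ModularParametrizationData W N) (p : ℕ) (hp : p.Prime),
    PSRow W p → p ^ 2 ∣ N → ¬ W.HasIrreducibleModPGaloisRep p →
    ¬ ((W.quadraticTwist (((-1 : ℤ) ^ (p / 2) * p : ℤ) : ℚ)).HasGoodReductionAt
          ((Rat.HeightOneSpectrum.primesEquiv (R := ℤ)).symm ⟨p, hp⟩) ∨
        (W.quadraticTwist (((-1 : ℤ) ^ (p / 2) * p : ℤ) : ℚ)).HasMultiplicativeReductionAt
          ((Rat.HeightOneSpectrum.primesEquiv (R := ℤ)).symm ⟨p, hp⟩)) →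
    (∀ z ∈ D.L.lattice, ∃ w ∈ periodLattice D.f, z = D.c * w) →
    EtaleExitAt W p D →
    ¬ (p : ℤ) ∣ D.maninConstant

/-- The residual restricted to the PS rows (same binders as the crux, plus `PSRow`). -/
def ResidualPS : Prop :=
  ∀ (W : WeierstrassCurve ℚ) [W.IsElliptic] [W.IsGloballyMinimal] {N : ℕ} [NeZero N]
    (D : ModularParametrizationData W N) (p : ℕ) (hp : p.Prime),
    PSRow W p → p ^ 2 ∣ N → ¬ W.HasIrreducibleModPGaloisRep p →
    ¬ ((W.quadraticTwist (((-1 : ℤ) ^ (p / 2) * p : ℤ) : ℚ)).HasGoodReductionAt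
          ((Rat.HeightOneSpectrum.primesEquiv (R := ℤ)).symm ⟨p, hp⟩) ∨
        (W.quadraticTwist (((-1 : ℤ) ^ (p / 2) * p : ℤ) : ℚ)).HasMultiplicativeReductionAt
          ((Rat.HeightOneSpectrum.primesEquiv (R := ℤ)).symm ⟨p, hp⟩)) →
    (∀ z ∈ D.L.lattice, ∃ w ∈ periodLattice D.f, z = D.c * w) →
    ¬ (p : ℤ) ∣ D.maninConstant

/-- Glue: transfer + orientation law ⇒ the PS-restricted residual. -/
theorem residualPS_of (h₁ : HalfTwistOrdinaryTransfer) (h₂ : EtaleExitPS) : ResidualPS := by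
  intro W _ _ N _ D p hp hrow hsq hred htw hopt
  exact h₁ W D p hp hrow hsq hred htw hopt (h₂ W D p hp hrow hsq hred htw hopt)

end Summit.BirchSwinnertonDyer.BirchSwinnertonDyer.Cruxes.EisensteinAdditiveManinResidual.HalfTwistRaynaudWindow
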